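import Summits.BirchSwinnertonDyer.BirchSwinnertonDyer.Theorems.GenusKolyvaginAtTwoShaCardDvdPowAtTwoPosTOnCut
import Summits.BirchSwinnertonDyer.BirchSwinnertonDyer.Theorems.GenusKolyvaginAtTwoShaCardDvdPowAtTwoPosTB2QSignFree
import HarnessLib

/-!
# Route `GenusKolyvaginAtTwo`, crux U⁺_T `ShaCardDvdPowAtTwoPosT` (stmt-BirchSwinnertonDyer-23378), LINE «rational_pair_descent_pos» —
# U⁺_T ON THE CUT, SORRY-FREE: `#Ш(E/K)[2^∞] ∣ 2^(2M₀)` on the Δ>0 live configuration (Q2, an odd multiplicative prime, `w(E) = 1`,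
# a globally minimal 2-Selmer-minimal twin model with `ord₂ c(Wd) = 0`) = the statement of the proposed restatement U⁺_T′ (R9 §1 / R9-FINAL)

Seat `bsd-line-gk2-p1` g20 (LEAD, cell `bsd-f1-sign2`), `--supports stmt-BirchSwinnertonDyer-23378` (helper; closes nothing: U⁺_T as filed is unconditional
and has no cut — this is the LIVE BRANCH of the registered composition `…RationalPairDescentPos.ShaCardDvdPowAtTwoPosT_of_stubs`, skeleton v1.2, whose
remaining sorries are the item-24880 stub and the declared residual off the cut).  THEOREMS ONLY.  BSD is NOT proved by any of this; U⁺_T AS FILED is NOT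
proved; the Δ>0 branch of the leaf also needs L⁺_T (open, road (E4)⁺) and the supply.

* `shaCardDvdPowAtTwoPosT_onCut` — ONCUT⁺ (gk2-p3 g27 `natCard_primaryComponent_sha_two_dvd_pow_onOddTwinCut_of_selmerExponent`: RANKQ⁺, sign-free pair
  sandwich with the archimedean bit, TWINPOINT) fed by B2Q⁺ (gk2-p5 g31 `stub_b2qSignFree` = Kolyvagin's Theorem B₂ at 2 over `ℚ`, sharp, sign-free:
  frame p754192 ∘ gk2-p4 g23's regular signed pair-Čebotarev p754753), in EXACTLY the binder order of the proposed U⁺_T′ text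
  (`Cruxes/KolyvaginExactAtTwoPosDiscT/Lines/SketchPos_R9final.lean`, `ShaCardDvdPowAtTwoPosT'`): the by-name closer of U⁺_T′ is `exact` this theorem.

References: [McCallumLMS1991] §5 Thm. 5.3–5.4, Cor. 5.6, Prop. 4.7; [Kolyvagin1989Izv] Thm. B₂; [GrossLMS1991] §3 (3.1)–(3.3), §5 Prop. 5.3;
[Kramer1981] Thm. 1, §2 Prop. 3; [MazurRubin2010] Cor. 3.4 (i).
-/

set_option autoImplicit false
-- the Theorems namespace of this sub repeats the summit name by design (D-0017 nested layout)
set_option linter.dupNamespace false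

noncomputable section

open scoped Classical

namespace Summit.BirchSwinnertonDyer.BirchSwinnertonDyer.Theorems.GenusExact.RationalPairDescentPos

open WeierstrassCurve NumberField IsDedekindDomain Field Literature.NumberTheory.EllipticCurves
  Literature.NumberTheory.GaloisRepresentations Literature.NumberTheory.EllipticCurves.ModularForms
open Summit.BirchSwinnertonDyer.BirchSwinnertonDyer.Theses.GenusKolyvaginAtTwo
open Summit.BirchSwinnertonDyer.BirchSwinnertonDyer.Theorems.GenusExact.PlusDescent

/-- **U⁺_T ON THE CUT (sorry-free): `#Ш(E/K)[2^∞] ∣ 2^(2M₀)`** on the Δ>0 odd-Tamagawa habitat frame of U⁺_T with the antecedent Q2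
`KolyvaginRelationAtTwo`, an odd prime `v` of multiplicative reduction (the non-phantom input of B2Q⁺), `w(E) = 1`, and a globally minimal
2-Selmer-minimal model `Wd ≅ E^(d_K)` with `ord₂ c(Wd) = 0` — binders = the proposed restatement U⁺_T′ VERBATIM (idle Kolyvagin binders dropped).
Proof: gk2-p3 g27's descent on the odd-twin cut fed by gk2-p5 g31's sign-free sharp exponent.  BSD is NOT proved by this; U⁺_T as filed is NOT proved.
[cite: McCallumLMS1991, §5 Cor. 5.6] [cite: Kolyvagin1989Izv, Thm. B₂] [cite: Kramer1981, Thm. 1] [cite: MazurRubin2010, Cor. 3.4 (i)] -/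
theorem shaCardDvdPowAtTwoPosT_onCut :
    KolyvaginRelationAtTwo → ∀ (W : WeierstrassCurve ℚ) [W.IsElliptic] [W.IsGloballyMinimal] [NeZero (W.conductorNorm ℤ)], ¬ W.HasCM → Odd W.tamagawaProduct → ∀ (v : IsDedekindDomain.HeightOneSpectrum (NumberField.RingOfIntegers ℚ)), ((2 : ℕ) : NumberField.RingOfIntegers ℚ) ∉ v.asIdeal → ((W.conductorNorm ℤ : ℕ) : NumberField.RingOfIntegers ℚ) ∈ v.asIdeal → W.HasMultiplicativeReductionAt v → 0 < W.Δ → ∀ (K : Type) [Field K] [NumberField K], Literature.NumberTheory.EllipticCurves.IsImaginaryQuadratic K → Odd (NumberField.discr K) → NumberField.discr K ≠ -3 → Literature.NumberTheory.EllipticCurves.SatisfiesHeegnerHypothesis (W.conductorNorm ℤ) K → ¬ IsSquare ((NumberField.discr K : ℚ) * -|W.Δ|) → ¬ IsSquare ((NumberField.discr K : ℚ) * (-(2 * |W.Δ|))) → (∀ n : ℕ, 0 < n → W.HasSurjectiveModNGaloisRep ((2 : ℤ) ^ n)) → ∀ (Dt : Literature.NumberTheory.EllipticCurves.ModularForms.ModularParametrizationData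 W (W.conductorNorm ℤ)) (β : ℤ) (ι : K →+* ℂ) (d₁ : Literature.NumberTheory.EllipticCurves.KolyvaginHeegnerData Dt β ι 1), ¬ IsOfFinAddOrder d₁.derivedPoint → ∀ (M₀ : ℕ), (∃ Q : (W.baseChange (Literature.NumberTheory.EllipticCurves.ringClassField K ι 1)).toAffine.Point, ((2 ^ M₀ : ℕ) : ℤ) • Q = d₁.derivedPoint) → (¬ ∃ Q : (W.baseChange (Literature.NumberTheory.EllipticCurves.ringClassField K ι 1)).toAffine.Point, ((2 ^ (M₀ + 1) : ℕ) : ℤ) • Q = d₁.derivedPoint) → W.rootNumber = 1 → ∀ (Wd : WeierstrassCurve ℚ) [Wd.IsElliptic] [Wd.IsGloballyMinimal], (∃ C : WeierstrassCurve.VariableChange ℚ, C • W.quadraticTwist (NumberField.discr K : ℚ) = Wd) → Nat.card (Wd.selmerGroup 2) = 2 → padicValNat 2 Wd.tamagawaProduct = 0 → Nat.card (AddCommGroup.primaryComponent (W.baseChange K).sha 2) ∣ 2 ^ (2 * M₀) := by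
  intro hQ2 W _ _ _ hcm hT v h2v hNv hmult hpos K _ _ hIQ hodd h3 hHe hsq1 hsq2 hρ Dt β ι d₁ hy M₀ _hdiv hndiv hw Wd _ _ hWd hSel hTam
  have hs2 : W.HasSurjectiveModNGaloisRep 2 := by simpa using hρ 1 one_pos
  exact natCard_primaryComponent_sha_two_dvd_pow_onOddTwinCut_of_selmerExponent W K hT hpos hIQ hodd hHe hs2 Dt β ι d₁ hy M₀ hndiv hw Wd
    hWd hSel hTam (fun M s₀ hs₀ ↦ stub_b2qSignFree hQ2 W hcm hT v h2v hNv hmult K hIQ hodd h3 hHe hsq1 hsq2 hρ Dt β ι d₁ M₀ hndiv hw M s₀ hs₀)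

end Summit.BirchSwinnertonDyer.BirchSwinnertonDyer.Theorems.GenusExact.RationalPairDescentPos

end
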